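import Literature.NumberTheory.EllipticCurves.HidaFamilyGaloisRepDatum
import Literature.NumberTheory.EllipticCurves.InertiaTameFactorizationProofs
import Literature.NumberTheory.EllipticCurves.MultiplicativeUnramifiedTorsionProofs
import Literature.NumberTheory.EllipticCurves.GeomPointsGaloisModule
import Literature.NumberTheory.EllipticCurves.GreenbergSelmer
import Literature.NumberTheory.GaloisRepresentations.DecompositionGroupOfCompletion
import Literature.NumberTheory.GaloisRepresentations.IntegralGaloisActionProofs
import Mathlib.RingTheory.Filtration
import Mathlib.Topology.Algebra.Nonarchimedean.AdicTopology
import Mathlib.RingTheory.Frobenius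
import Summits.BirchSwinnertonDyer.BirchSwinnertonDyer.Theorems.OneSidedTwistSqueezeX9KatoDivisibilityX9ULedgerDefs
import Summits.BirchSwinnertonDyer.BirchSwinnertonDyer.Theorems.OneSidedTwistSqueezeX9KatoDivisibilityX9ULedgerEntrywiseCongruences
import Summits.BirchSwinnertonDyer.BirchSwinnertonDyer.Theorems.OneSidedTwistSqueezeX9KatoDivisibilityX9ULedgerTameKummer

set_option autoImplicit false

/-!
# Tame family monodromy: `ρ_D(I_𝔓)` is pro-cyclic through a tame generator modulo every `𝔪^j`
# (helpers for crux stmt-BirchSwinnertonDyer-20547 `KatoDivisibilityX9`, line `prime_adapted_tau`, stub 3 (U))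

Port (verbatim, re-homed) of §J2 and §J6 of the bsd-f3-mu cell's kernel-checked sketch `Sketch71.lean` v5
f376123484d02b28 (planner-bsd-f3-mu-desc g71; standalone check `d71/J71a.lean` 4d4b53f927e74da5; port plan PORT-PLAN-72
file P7, desc g72).  For a Hida datum `D : HidaFamilyGaloisRepDatum W p 𝕀` (tree; dot notation), with `D.rhoMat`,
`EntryMem`, `D.OneParamInertiaAt` of `…ULedgerDefs.lean`, the congruence kernels of `…ULedgerEntrywiseCongruences.lean`
and the Kummer inputs of `…ULedgerTameKummer.lean`:

* §J2 datum plumbing: `isNoetherianRing`, `natCast_mem_maximalIdeal` (`p ∈ 𝔪_𝕀`), `isOpen_maximalIdeal_pow_of_isAdic`,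
  `finite_quotient_maximalIdeal_pow`, `continuous_rhoMat_apply`, `isOpen_setOf_entryMem`, `rhoMod_eq_iff_entryMem`,
  `entryMem_rhoMat_sub_one_of_mem_inertia` (residual triviality of `ρ_D` on `I_𝔓` at a multiplicative `v ∤ p` with
  `p ∣ ord_v Δ`, field (vi) + the tree's `smul_geomTorsion_eq_of_mem_inertia_of_hasMultiplicativeReductionAt_of_dvd`);
* §J6 `rhoMat_pow/mul/one`, `eq_of_forall_entryMem_pow` (Krull), `kummer_level` — KUMMER AT LEVEL `j+1`: if
  `ρ_D(I_𝔓)` is commutative modulo `𝔪^(j+1)` then `ρ_D mod 𝔪^(j+1)` on `I_𝔓` factors through the Kummer character of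
  `π^{1/p^j}`, on which a mover `τ` of `W[p²]` is primitive; `congr_pow_of_mem_inertia` (induction on `j`: every
  `ρ_D(σ)`, `σ ∈ I_𝔓`, is `≡ ρ_D(τ)^k (mod 𝔪^j)` for all `j`); `rhoMat_conj_eq_rhoMat_pow` — the TAME RELATION
  `ρ_D(φ τ φ⁻¹) = ρ_D(τ^{N v})` for a normalising Frobenius `φ`; `exists_smul_of_sq_zero` — one-parameter inertia
  through `τ` once `(ρ_D(τ) − 1)² = 0`.

Consumed by `…ULedger.lean` (`tameFamilyMonodromyAt_holds`).  No ledger item is closed here; BSD is proved for no curve.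
References: [SerreInventiones1972] §1.3 Prop. 2, n° 1.12; [Hida1986] p. 559; [SerreAbelianLadic1968] Ch. I §2.1.
-/

noncomputable section

open scoped Classical MatrixGroups NumberField
open Matrix

/-! ## §J2. Datum plumbing: Noetherianity, `p ∈ 𝔪`, open congruence fibres, finite quotients, residual triviality -/

namespace Literature.NumberTheory.EllipticCurves.HidaFamilyGaloisRepDatum

open Literature.NumberTheory.EllipticCurves Literature.NumberTheory.GaloisRepresentations
open Field IsDedekindDomain NumberField
open Summit.BirchSwinnertonDyer.BirchSwinnertonDyer.Theorems.OneSidedTwistSqueezeX9KatoDivisibilityX9ULedger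

variable {W : WeierstrassCurve ℚ} {p : ℕ} [Fact p.Prime] {I : Type} [CommRing I] [IsDomain I]
  [IsLocalRing I] [TopologicalSpace I] [IsTopologicalRing I] [Algebra (IwasawaAlgebra p) I]
  (D : HidaFamilyGaloisRepDatum W p I)

include D in
/-- `𝕀` is Noetherian (module-finite over the Noetherian `Λ`). [folklore] -/
theorem isNoetherianRing : IsNoetherianRing I := by
  haveI := D.moduleFinite
  exact isNoetherian_of_tower (IwasawaAlgebra p) (isNoetherian_of_isNoetherianRing_of_finite (IwasawaAlgebra p) I)

include D in
/-- `p ∈ 𝔪_𝕀` (the residue field has characteristic `p`). [folklore] -/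
theorem natCast_mem_maximalIdeal : (p : I) ∈ IsLocalRing.maximalIdeal I := by
  haveI := D.charP_residueField
  rw [← IsLocalRing.residue_eq_zero_iff, map_natCast]
  exact CharP.cast_eq_zero _ p

include D in
/-- `𝔪^n` is open (the topology of `𝕀` is `𝔪`-adic, field (ii); named apart from Mathlib's
`IsLocalRing.isOpen_maximalIdeal_pow` for compact Noetherian local rings). [folklore] -/
theorem isOpen_maximalIdeal_pow_of_isAdic (n : ℕ) : IsOpen ((IsLocalRing.maximalIdeal I ^ n : Ideal I) : Set I) :=
  (isAdic_iff.mp D.isAdic).1 n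

include D in
/-- `𝕀 / 𝔪^n` is finite. [folklore] -/
theorem finite_quotient_maximalIdeal_pow (n : ℕ) : Finite (I ⧸ IsLocalRing.maximalIdeal I ^ n) := by
  haveI : Finite (I ⧸ IsLocalRing.maximalIdeal I) := D.finite_residueField
  haveI := D.isNoetherianRing
  exact Ideal.finite_quotient_pow (IsNoetherian.noetherian (IsLocalRing.maximalIdeal I)) n

/-- `σ ↦ ρ(σ)_{ab}` is continuous. [folklore] -/
theorem continuous_rhoMat_apply (a b : Fin 2) : Continuous fun σ : absoluteGaloisGroup ℚ => D.rhoMat σ a b :=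
  ((Units.continuous_val.comp (map_continuous D.rho)).matrix_elem a b)

/-- **Open congruence fibres**: for an open ideal `P`, `{σ | ρ(σ) ≡ ρ(σ₀) (mod P)}` is open in `Γ_ℚ`. [folklore] -/
theorem isOpen_setOf_entryMem {P : Ideal I} (hP : IsOpen (P : Set I)) (σ₀ : absoluteGaloisGroup ℚ) :
    IsOpen {σ : absoluteGaloisGroup ℚ | EntryMem P (D.rhoMat σ - D.rhoMat σ₀)} := by
  have e : {σ : absoluteGaloisGroup ℚ | EntryMem P (D.rhoMat σ - D.rhoMat σ₀)} =
      ⋂ a : Fin 2, ⋂ b : Fin 2, (fun σ => D.rhoMat σ a b - D.rhoMat σ₀ a b) ⁻¹' (P : Set I) := by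
    ext σ
    simp only [Set.mem_setOf_eq, Set.mem_iInter, Set.mem_preimage, SetLike.mem_coe, EntryMem, Matrix.sub_apply]
  rw [e]
  exact isOpen_iInter_of_finite fun a => isOpen_iInter_of_finite fun b =>
    hP.preimage ((D.continuous_rhoMat_apply a b).sub continuous_const)

/-- `ρ mod P` agrees at `σ, σ₀` iff `ρ(σ) ≡ ρ(σ₀) (mod P)` entrywise. [folklore] -/
theorem rhoMod_eq_iff_entryMem (P : Ideal I) (σ σ₀ : absoluteGaloisGroup ℚ) :
    D.rhoMod P σ = D.rhoMod P σ₀ ↔ EntryMem P (D.rhoMat σ - D.rhoMat σ₀) := by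
  rw [EntryMem.iff_map_eq, Units.ext_iff, coe_rhoMod_apply, coe_rhoMod_apply]

/-- **Residual triviality of inertia at a Steinberg prime with `p ∣ ord_v Δ`** (field (vi) + the tree's
`smul_geomTorsion_eq_of_mem_inertia_of_hasMultiplicativeReductionAt_of_dvd`): `ρ_D(τ) ≡ 1 (mod 𝔪)` for
`τ ∈ I_𝔓`, `𝔓 ∣ v`. [cite: SerreInventiones1972, n° 1.12] -/
theorem entryMem_rhoMat_sub_one_of_mem_inertia [W.IsElliptic] {v : HeightOneSpectrum (𝓞 ℚ)}
    (hmult : W.HasMultiplicativeReductionAt v) (hpv : (p : 𝓞 ℚ) ∉ v.asIdeal) (hdvd : p ∣ W.ordMinimalDiscriminant v)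
    {𝔓 : Ideal (absIntegers (𝓞 ℚ) ℚ)} (h𝔓 : 𝔓 ∈ v.primesAbove) {τ : absoluteGaloisGroup ℚ}
    (hτ : τ ∈ 𝔓.inertia (absoluteGaloisGroup ℚ)) :
    EntryMem (IsLocalRing.maximalIdeal I) (D.rhoMat τ - 1) := by
  haveI := D.charP_residueField
  obtain ⟨e, P, hconj⟩ := D.exists_conj_residual
  have hfix : ∀ Q : W.geomTorsion (p : ℤ), τ • Q = Q := fun Q =>
    W.smul_geomTorsion_eq_of_mem_inertia_of_hasMultiplicativeReductionAt_of_dvd hmult (Fact.out : p.Prime) hpv hdvd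
      h𝔓 hτ Q
  have hM : Matrix.of (fun i j : Fin 2 =>
      ((e.symm (τ • e (Pi.single j 1)) i : ZMod p).cast : IsLocalRing.ResidueField I)) = 1 := by
    ext i j
    rw [Matrix.of_apply, hfix, AddEquiv.symm_apply_apply, Matrix.one_apply, Pi.single_apply]
    split_ifs with h
    · subst h; exact ZMod.cast_one dvd_rfl
    · exact ZMod.cast_zero
  have h1 : (D.rhoMat τ).map (IsLocalRing.residue I) = 1 := by
    rw [rhoMat, hconj τ, hM, mul_one, ← Units.val_mul, mul_inv_cancel, Units.val_one]
  intro a b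
  rw [Matrix.sub_apply, ← IsLocalRing.residue_eq_zero_iff, map_sub, sub_eq_zero]
  have := congrArg (fun M : Matrix (Fin 2) (Fin 2) (IsLocalRing.ResidueField I) => M a b) h1
  simp only [Matrix.map_apply] at this
  rw [this]
  rcases eq_or_ne a b with h | h
  · subst h; rw [Matrix.one_apply_eq, Matrix.one_apply_eq, map_one]
  · rw [Matrix.one_apply_ne h, Matrix.one_apply_ne h, map_zero]


end Literature.NumberTheory.EllipticCurves.HidaFamilyGaloisRepDatum

/-! ## §J6. The family side: `ρ_D(I_𝔓)` is pro-cyclic through `τ` modulo every `𝔪^j`; the tame relation -/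

namespace Literature.NumberTheory.EllipticCurves.HidaFamilyGaloisRepDatum

open Literature Literature.NumberTheory.EllipticCurves Literature.NumberTheory.GaloisRepresentations
open Field IsDedekindDomain NumberField IsDedekindDomain.HeightOneSpectrum
open Literature.NumberTheory.EllipticCurves.InertiaTame
open Summit.BirchSwinnertonDyer.BirchSwinnertonDyer.Theorems.OneSidedTwistSqueezeX9KatoDivisibilityX9ULedger

variable {W : WeierstrassCurve ℚ} {p : ℕ} [Fact p.Prime] {I : Type} [CommRing I] [IsDomain I]
  [IsLocalRing I] [TopologicalSpace I] [IsTopologicalRing I] [Algebra (IwasawaAlgebra p) I]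
  (D : HidaFamilyGaloisRepDatum W p I)

/-- `rhoMat` is multiplicative: powers. -/
theorem rhoMat_pow (σ : absoluteGaloisGroup ℚ) (k : ℕ) : D.rhoMat (σ ^ k) = D.rhoMat σ ^ k := by
  rw [rhoMat, rhoMat, map_pow, Units.val_pow_eq_pow_val]

/-- `rhoMat` is multiplicative: products. -/
theorem rhoMat_mul (σ σ' : absoluteGaloisGroup ℚ) : D.rhoMat (σ * σ') = D.rhoMat σ * D.rhoMat σ' := by
  rw [rhoMat, rhoMat, rhoMat, map_mul, Units.val_mul]

/-- `rhoMat 1 = 1`. -/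
theorem rhoMat_one : D.rhoMat 1 = 1 := by rw [rhoMat, map_one, Units.val_one]

include D in
/-- Krull's intersection theorem for matrices over `𝕀`. [folklore] -/
theorem eq_of_forall_entryMem_pow {A B : Matrix (Fin 2) (Fin 2) I}
    (h : ∀ n : ℕ, EntryMem (IsLocalRing.maximalIdeal I ^ n) (A - B)) : A = B := by
  haveI := D.isNoetherianRing
  have hK := Ideal.iInf_pow_eq_bot_of_isLocalRing (IsLocalRing.maximalIdeal I)
    (IsLocalRing.maximalIdeal.isMaximal I).ne_top
  ext a b
  have hab : (A - B) a b ∈ (⨅ n : ℕ, IsLocalRing.maximalIdeal I ^ n : Ideal I) := Ideal.mem_iInf.mpr fun n => h n a b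
  rw [hK, Ideal.mem_bot, Matrix.sub_apply, sub_eq_zero] at hab
  exact hab

section Steinberg

variable [W.IsElliptic] {v : HeightOneSpectrum (𝓞 ℚ)} {𝔓 : Ideal (absIntegers (𝓞 ℚ) ℚ)} {τ : absoluteGaloisGroup ℚ}

/-- **KUMMER AT LEVEL `j+1` for the family.**  At a multiplicative `v ∤ p` with `p ∣ ord_v Δ`, `τ ∈ I_𝔓` a mover of
`W[p²]`, `j ≥ 1`, and `ρ_D(I_𝔓)` commutative modulo `𝔪^(j+1)`: the reduction `ρ_D mod 𝔪^(j+1)` on `I_𝔓` is a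
continuous homomorphism to a finite abelian group killed by `p^j`, hence factors through the Kummer character of
`π^{1/p^j}`, on which `τ` is primitive; so (1) every `ρ_D(σ)`, `σ ∈ I_𝔓`, is `≡ ρ_D(τ)^k (mod 𝔪^(j+1))`, and (2) two
inertia elements acting alike on `p^j`-th roots of uniformizers are congruent `mod 𝔪^(j+1)`.
[cite: SerreInventiones1972, §1.3 Prop. 2 and n° 1.12] [cite: Hida1986, p. 559] -/
theorem kummer_level (hmult : W.HasMultiplicativeReductionAt v) (hpv : (p : 𝓞 ℚ) ∉ v.asIdeal)
    (hdvd : p ∣ W.ordMinimalDiscriminant v) (h𝔓 : 𝔓 ∈ v.primesAbove)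
    (hτ : τ ∈ 𝔓.inertia (absoluteGaloisGroup ℚ)) (hmov : ∃ Q : W.geomTorsion ((p ^ 2 : ℕ) : ℤ), τ • Q ≠ Q)
    {j : ℕ} (hj : 1 ≤ j)
    (hcomm : ∀ x ∈ 𝔓.inertia (absoluteGaloisGroup ℚ), ∀ y ∈ 𝔓.inertia (absoluteGaloisGroup ℚ),
      EntryMem (IsLocalRing.maximalIdeal I ^ (j + 1)) (D.rhoMat x * D.rhoMat y - D.rhoMat y * D.rhoMat x)) :
    (∀ σ ∈ 𝔓.inertia (absoluteGaloisGroup ℚ), ∃ k : ℕ,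
        EntryMem (IsLocalRing.maximalIdeal I ^ (j + 1)) (D.rhoMat σ - D.rhoMat τ ^ k)) ∧
    (∀ σ ∈ 𝔓.inertia (absoluteGaloisGroup ℚ), ∀ σ' ∈ 𝔓.inertia (absoluteGaloisGroup ℚ),
        (∀ (π : ℚ) (z : AlgebraicClosure ℚ), v.valuation ℚ π = WithZero.exp (-1 : ℤ) →
            z ^ (p ^ j) = algebraMap ℚ (AlgebraicClosure ℚ) π → σ • z = σ' • z) →
        EntryMem (IsLocalRing.maximalIdeal I ^ (j + 1)) (D.rhoMat σ - D.rhoMat σ')) := by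
  have hp : p.Prime := Fact.out
  set P : Ideal I := IsLocalRing.maximalIdeal I ^ (j + 1) with hP
  have h1 : ∀ σ ∈ 𝔓.inertia (absoluteGaloisGroup ℚ), EntryMem (IsLocalRing.maximalIdeal I) (D.rhoMat σ - 1) :=
    fun σ hσ => D.entryMem_rhoMat_sub_one_of_mem_inertia hmult hpv hdvd h𝔓 hσ
  -- the reduction `f = ρ mod 𝔪^(j+1)` and the image `H` of inertia
  set f : absoluteGaloisGroup ℚ →* GL (Fin 2) (I ⧸ P) := D.rhoMod P with hf
  set H : Subgroup (GL (Fin 2) (I ⧸ P)) := (𝔓.inertia (absoluteGaloisGroup ℚ)).map f with hH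
  have hfeq : ∀ x y : absoluteGaloisGroup ℚ, f x = f y ↔ EntryMem P (D.rhoMat x - D.rhoMat y) :=
    fun x y => D.rhoMod_eq_iff_entryMem P x y
  -- `H` is commutative
  have hHcomm : ∀ a b : H, a * b = b * a := by
    rintro ⟨_, x, hx, rfl⟩ ⟨_, y, hy, rfl⟩
    apply Subtype.ext
    change f x * f y = f y * f x
    rw [← map_mul, ← map_mul, hfeq, rhoMat_mul, rhoMat_mul]
    exact hcomm x hx y hy
  letI : CommGroup H := { (inferInstance : Group H) with mul_comm := hHcomm }
  -- finiteness / topology of `T := Additive H`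
  haveI : Finite (I ⧸ P) := D.finite_quotient_maximalIdeal_pow (j + 1)
  haveI : Finite (Matrix (Fin 2) (Fin 2) (I ⧸ P)) := Pi.finite
  haveI : Finite (GL (Fin 2) (I ⧸ P)) := inferInstance
  haveI : Finite H := inferInstance
  haveI : Finite (Additive H) := Finite.of_equiv H Additive.ofMul
  letI : TopologicalSpace (Additive H) := ⊥
  haveI : DiscreteTopology (Additive H) := ⟨rfl⟩
  -- the map `a`
  let a : 𝔓.inertia (absoluteGaloisGroup ℚ) → Additive H := fun σ =>
    Additive.ofMul ⟨f σ, Subgroup.mem_map_of_mem f σ.2⟩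
  have ha_def : ∀ σ : 𝔓.inertia (absoluteGaloisGroup ℚ),
      ((Additive.toMul (a σ) : H) : GL (Fin 2) (I ⧸ P)) = f σ := fun _ => rfl
  have ha : ∀ σ σ', a (σ * σ') = a σ + a σ' := by
    intro σ σ'
    apply Additive.toMul.injective
    apply Subtype.ext
    rw [toMul_add, Subgroup.coe_mul, ha_def, ha_def, ha_def, Subgroup.coe_mul, map_mul]
  -- `a` is continuous: its fibres are congruence classes
  have hac : Continuous a := by
    refine continuous_of_isOpen_fibers a fun σ₀ => ?_
    have e : {σ : 𝔓.inertia (absoluteGaloisGroup ℚ) | a σ = a σ₀} =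
        Subtype.val ⁻¹' {σ : absoluteGaloisGroup ℚ | EntryMem P (D.rhoMat σ - D.rhoMat σ₀)} := by
      ext σ
      simp only [Set.mem_setOf_eq, Set.mem_preimage]
      rw [← hfeq, ← Additive.toMul.injective.eq_iff, Subtype.ext_iff, ha_def, ha_def]
    rw [e]
    exact (D.isOpen_setOf_entryMem (D.isOpen_maximalIdeal_pow_of_isAdic (j + 1)) σ₀).preimage continuous_subtype_val
  -- `T` is killed by `p^j`
  have hT : ∀ t : Additive H, p ^ j • t = 0 := by
    intro t
    obtain ⟨σ, hσ, hσeq⟩ := Subgroup.mem_map.mp (Additive.toMul t).2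
    apply Additive.toMul.injective
    rw [toMul_nsmul, toMul_zero]
    apply Subtype.ext
    rw [SubmonoidClass.coe_pow, OneMemClass.coe_one, ← hσeq, ← map_pow, ← map_one f, hfeq, rhoMat_pow, rhoMat_one]
    exact entryMem_pow_prime_pow_sub_one D.natCast_mem_maximalIdeal (h1 σ hσ) j
  -- a uniformizer and a `p^j`-th root of it
  obtain ⟨π, hπ⟩ := IsDedekindDomain.HeightOneSpectrum.valuation_exists_uniformizer ℚ v
  have hn : 0 < p ^ j := pow_pos hp.pos j
  obtain ⟨z, hz⟩ := IsAlgClosed.exists_pow_nat_eq (algebraMap ℚ (AlgebraicClosure ℚ) π) hn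
  have hnv : ((p ^ j : ℕ) : 𝓞 ℚ) ∉ v.asIdeal := by
    intro h
    apply hpv
    rw [Nat.cast_pow] at h
    exact v.isPrime.mem_of_pow_mem j h
  have hz0 : z ≠ 0 := by
    intro h0
    rw [h0, zero_pow hn.ne', eq_comm, map_eq_zero] at hz
    rw [hz, map_zero] at hπ
    exact WithZero.coe_ne_zero hπ.symm
  -- primitivity of `θ_z(τ)` (E-side)
  have hprim := W.isPrimitiveRoot_smul_div_of_smul_ne hmult hp hpv hdvd h𝔓 hτ hmov hπ hj hz
  have hτz : τ • z = (τ • z / z) * z := by rw [div_mul_cancel₀ _ hz0]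
  refine ⟨fun σ hσ => ?_, fun σ hσ σ' hσ' hzz => ?_⟩
  · obtain ⟨k, hk⟩ := forall_apply_eq_nsmul_of_isPrimitiveRoot v hn hnv hπ hz h𝔓 hT a hac ha
      (τ₁ := ⟨τ, hτ⟩) hprim hτz ⟨σ, hσ⟩
    refine ⟨k, ?_⟩
    rw [← rhoMat_pow, ← hfeq, map_pow]
    have := congrArg (fun t => ((Additive.toMul t : H) : GL (Fin 2) (I ⧸ P))) hk
    simpa only [toMul_nsmul, SubmonoidClass.coe_pow, ha_def] using this
  · have h := apply_eq_apply_of_smul_root_eq v hn hnv hπ hz h𝔓 hT a hac ha (σ := ⟨σ, hσ⟩) (σ' := ⟨σ', hσ'⟩)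
      (hzz π z hπ hz)
    rw [← hfeq]
    have := congrArg (fun t => ((Additive.toMul t : H) : GL (Fin 2) (I ⧸ P))) h
    simpa only [ha_def] using this

/-- **`ρ_D(I_𝔓)` IS PRO-CYCLIC THROUGH `τ`**: for every `j`, every `ρ_D(σ)`, `σ ∈ I_𝔓`, is congruent to a power of
`ρ_D(τ)` modulo `𝔪^j` (induction on `j`: the level-`j` statement makes the image modulo `𝔪^(j+1)` abelian,
`entryMem_commutator_of_congr_pow`, and then `kummer_level` applies). [cite: SerreInventiones1972, §1.3 Prop. 2 and n° 1.12] -/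
theorem congr_pow_of_mem_inertia (hmult : W.HasMultiplicativeReductionAt v) (hpv : (p : 𝓞 ℚ) ∉ v.asIdeal)
    (hdvd : p ∣ W.ordMinimalDiscriminant v) (h𝔓 : 𝔓 ∈ v.primesAbove)
    (hτ : τ ∈ 𝔓.inertia (absoluteGaloisGroup ℚ)) (hmov : ∃ Q : W.geomTorsion ((p ^ 2 : ℕ) : ℤ), τ • Q ≠ Q)
    (j : ℕ) :
    ∀ σ ∈ 𝔓.inertia (absoluteGaloisGroup ℚ), ∃ k : ℕ,
      EntryMem (IsLocalRing.maximalIdeal I ^ j) (D.rhoMat σ - D.rhoMat τ ^ k) := by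
  induction j with
  | zero =>
    intro σ _
    exact ⟨0, fun a b => by rw [pow_zero, Ideal.one_eq_top]; exact Submodule.mem_top⟩
  | succ j ih =>
    rcases Nat.eq_zero_or_pos j with hj0 | hj
    · subst hj0
      intro σ hσ
      refine ⟨0, ?_⟩
      rw [zero_add, pow_one, pow_zero]
      exact D.entryMem_rhoMat_sub_one_of_mem_inertia hmult hpv hdvd h𝔓 hσ
    · have hT1 := D.entryMem_rhoMat_sub_one_of_mem_inertia hmult hpv hdvd h𝔓 hτ
      refine (D.kummer_level hmult hpv hdvd h𝔓 hτ hmov hj fun x hx y hy => ?_).1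
      obtain ⟨a, ha⟩ := ih x hx
      obtain ⟨b, hb⟩ := ih y hy
      exact entryMem_commutator_of_congr_pow hT1 hj ha hb

/-- **THE TAME RELATION for every datum**: `ρ_D(φ τ φ⁻¹) = ρ_D(τ^ℓ)` for `φ` normalising `I_𝔓` and acting by
`ζ ↦ ζ^ℓ` on roots of unity of order prime to `v` (congruence at every level by `kummer_level` (2) and the root
computation `conj_smul_root_eq_pow_smul`; equality by Krull). [cite: SerreInventiones1972, §1.8 Prop. 6] -/
theorem rhoMat_conj_eq_rhoMat_pow (hmult : W.HasMultiplicativeReductionAt v) (hpv : (p : 𝓞 ℚ) ∉ v.asIdeal)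
    (hdvd : p ∣ W.ordMinimalDiscriminant v) (h𝔓 : 𝔓 ∈ v.primesAbove)
    (hτ : τ ∈ 𝔓.inertia (absoluteGaloisGroup ℚ)) (hmov : ∃ Q : W.geomTorsion ((p ^ 2 : ℕ) : ℤ), τ • Q ≠ Q)
    {φ : absoluteGaloisGroup ℚ}
    (hφI : ∀ σ ∈ 𝔓.inertia (absoluteGaloisGroup ℚ), φ * σ * φ⁻¹ ∈ 𝔓.inertia (absoluteGaloisGroup ℚ))
    {ℓ : ℕ} (hφζ : ∀ n : ℕ, (n : 𝓞 ℚ) ∉ v.asIdeal → ∀ ζ : AlgebraicClosure ℚ, ζ ^ n = 1 → φ • ζ = ζ ^ ℓ) :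
    D.rhoMat (φ * τ * φ⁻¹) = D.rhoMat (τ ^ ℓ) := by
  have hp : p.Prime := Fact.out
  apply D.eq_of_forall_entryMem_pow
  have hlev : ∀ j, 1 ≤ j →
      EntryMem (IsLocalRing.maximalIdeal I ^ (j + 1)) (D.rhoMat (φ * τ * φ⁻¹) - D.rhoMat (τ ^ ℓ)) := by
    intro j hj
    have hT1 := D.entryMem_rhoMat_sub_one_of_mem_inertia hmult hpv hdvd h𝔓 hτ
    have hcyc := D.congr_pow_of_mem_inertia hmult hpv hdvd h𝔓 hτ hmov j
    refine (D.kummer_level hmult hpv hdvd h𝔓 hτ hmov hj fun x hx y hy => ?_).2 _ (hφI τ hτ) _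
      (Subgroup.pow_mem _ hτ ℓ) fun π z hπ hz => ?_
    · obtain ⟨a, ha⟩ := hcyc x hx
      obtain ⟨b, hb⟩ := hcyc y hy
      exact entryMem_commutator_of_congr_pow hT1 hj ha hb
    · have hn : 0 < p ^ j := pow_pos hp.pos j
      have hnv : ((p ^ j : ℕ) : 𝓞 ℚ) ∉ v.asIdeal := by
        intro h
        apply hpv
        rw [Nat.cast_pow] at h
        exact v.isPrime.mem_of_pow_mem j h
      have hz0 : z ≠ 0 := by
        intro h0
        rw [h0, zero_pow hn.ne', eq_comm, map_eq_zero] at hz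
        rw [hz, map_zero] at hπ
        exact WithZero.coe_ne_zero hπ.symm
      exact conj_smul_root_eq_pow_smul v hn hnv hz hz0 h𝔓 hτ (hφζ (p ^ j) hnv)
  intro n
  rcases le_or_gt n 2 with h | h
  · exact (hlev 1 le_rfl).mono (Ideal.pow_le_pow_right h)
  · have := hlev (n - 1) (by omega)
    rwa [Nat.sub_add_cancel (by omega)] at this

/-- **ONE-PARAMETER INERTIA from pro-cyclicity and `ν² = 0`** (`exists_smul_eq_of_forall_congr`: Krull).
[cite: Ochiai2006, §3 Lemma 3.2] -/
theorem exists_smul_of_sq_zero (hmult : W.HasMultiplicativeReductionAt v) (hpv : (p : 𝓞 ℚ) ∉ v.asIdeal)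
    (hdvd : p ∣ W.ordMinimalDiscriminant v) (h𝔓 : 𝔓 ∈ v.primesAbove)
    (hτ : τ ∈ 𝔓.inertia (absoluteGaloisGroup ℚ)) (hmov : ∃ Q : W.geomTorsion ((p ^ 2 : ℕ) : ℤ), τ • Q ≠ Q)
    (hN : (D.rhoMat τ - 1) * (D.rhoMat τ - 1) = 0) {σ : absoluteGaloisGroup ℚ}
    (hσ : σ ∈ 𝔓.inertia (absoluteGaloisGroup ℚ)) : ∃ s : I, D.rhoMat σ - 1 = s • (D.rhoMat τ - 1) := by
  haveI := D.isNoetherianRing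
  refine exists_smul_eq_of_forall_congr _ _ fun j => ?_
  obtain ⟨k, hk⟩ := D.congr_pow_of_mem_inertia hmult hpv hdvd h𝔓 hτ hmov j σ hσ
  refine ⟨(k : I), ?_⟩
  have e : D.rhoMat τ ^ k = 1 + (k : I) • (D.rhoMat τ - 1) := by
    have := one_add_pow_of_sq_zero (D.rhoMat τ - 1) hN k
    rwa [add_sub_cancel] at this
  have e2 : D.rhoMat σ - 1 - (k : I) • (D.rhoMat τ - 1) = D.rhoMat σ - D.rhoMat τ ^ k := by
    rw [e]; abel
  rw [e2]
  exact hk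

end Steinberg

end Literature.NumberTheory.EllipticCurves.HidaFamilyGaloisRepDatum
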